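import Summits.HubbardSuperconductivity.HubbardLadder.Bounds.CouplingSiteActivitySmallness
import Summits.HubbardSuperconductivity.HubbardLadder.Bounds.TwistedPolymerRepresentation
import HarnessLib

/-!
# Kotecký–Preiss smallness of the twisted polymer activities (bounds.tex §12, Lemmas 12.3–12.4)

LINT.SIZE SPLIT (bounds g25 amendment 2026-08-21, same request number #181.5): the section
`Smallness` (`sum_norm_siteActivityC_mul_exp_le`) of the original #181.5 file now live in
`Bounds/CouplingSiteActivitySmallness.lean` (#181.5a), imported here; every declaration is byte-
identical to the staged v1 and in the original order.

HONEST FRAMING: ladder R1–R4 with certified numbers; no claim on H/H₀; bounds for model classes,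
no materials claim.

Cell `pub-hubbard`, LEAN FILING REQUEST #181 PART #181.5 (bounds g23). This file continues
#181.4 (`TwistedPolymerRepresentation`): there the grand-canonical partition function of the
seam-twisted `t–t'` Hubbard torus was written as a hard-core polymer gas
`Tr e^{-β(H_θ - μN)} = z₀^{L²} Ξ(ρ_θ)` with site activities `ρ_θ = siteActivityC P β U μ c_θ`, and
the Cauchy bound `|M_c(K)| ≤ (e² s)^{|K|} r^{|supp K|}` per bond cluster was proved. Here we
prove the **one-site Kotecký–Preiss smallness of the activities**, first for an arbitrary
bond-dependent coupling `c` on the bonds of a graph of maximal degree `Δ` (the tree's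
`sum_norm_siteActivity_mul_exp_le` — Ueltschi's estimate — ported verbatim from the uniform
coupling `τ` to `‖c_b‖ ≤ s`), and then for the twisted torus itself, with every constant explicit:

* `sum_norm_siteActivityC_mul_exp_le` — `Σ_{A ∋ x} |ρ_c(A)| e^{2|A|} ≤ 8Δ·λ`, `λ = e⁶ r₀² s`, if
  `(8Δ+1)² λ ≤ 1/2`, `|c_b| ≤ s ≤ 1`, `r ≤ r₀`, `1 ≤ r₀`;
* `ttGraph L = (n.n. torus graph) ⊔ (diagonal torus graph)`, `degree_ttGraph_le : deg ≤ 8`,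
  `ttGraph_adj_of_ttFluxCoupling_ne_zero` (the twisted coupling lives on its bonds),
  `norm_ttFluxCoupling_le : |c_θ(b)| ≤ |β| (2 + 2|t'|)` (uniformly in the twist `θ`);
* node `TwistedTorusActivitySmallness` (+ `_holds`, KERNEL-PROVED): for `L ≥ 3` and real
  `β, t', U, μ, θ` with `s := |β|(2+2|t'|) ≤ 1` and `65² e⁶ s ≤ 1/2`,
  `Tr e^{-β(H_θ-μN)} = z₀^{L²} Ξ(ρ_θ)` on the bond universe `hubbardBonds (ttGraph L)` AND
  `Σ_{A ∋ x} |ρ_θ(A)| e^{2|A|} ≤ 64 e⁶ s` for every site `x` — uniformly in `U`, `μ` (the site ratio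
  `r = 1` for real parameters) and in the twist `θ`.

Together with the winding dichotomy of #181.4 (`ρ_θ(A) = ρ_0(A)` unless `|A| ≥ L`) this is the
complete input of the abstract cluster-expansion step of bounds.tex Theorem 12 (i); what remains
for `HighTemperatureTwistInsensitivityTT'` (#181.1) is the tree's convergent cluster expansion
(`Literature.Probability.LatticeModels.ClusterExpansion*`) applied to the two activity families and
the tail over clusters containing a polymer of size `≥ L`.

References: D. Ueltschi, arXiv:cond-mat/9810320 (1999), §3 (the activity estimate);
R. Kotecký, D. Preiss, Comm. Math. Phys. 103 (1986) 491, Thm. 1 (the criterion it feeds);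
Xu et al., Science 384 (2024) eadh7691, eq. (1) (the `t–t'` torus).
-/

namespace Summit.HubbardSuperconductivity.HubbardLadder.Bounds

open Matrix Finset Literature.MathematicalPhysics.QuantumLattice
  Literature.MathematicalPhysics.QuantumFieldTheory Literature.Probability.LatticeModels
  Literature.Analysis.Complex.FiniteDifference
open scoped ComplexConjugate

/-! ### The `t–t'` bond graph of the torus and its degree -/

section TorusGraph

variable {L : ℕ} [NeZero L]

/-- The `t–t'` bond graph of the square torus `(ℤ/Lℤ)²`: nearest-neighbour ⊔ diagonal adjacency
(the hopping graph of `hubbardTorusTT'`). [cite: XuEtAl2024, eq. (1)] -/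
abbrev ttGraph (L : ℕ) : SimpleGraph (FermionTorus 2 L) :=
  fermionTorusGraph 2 L ⊔ fermionTorusDiagGraph L

omit [NeZero L] in
/-- Adjacency in the `t–t'` torus graph, unfolded. [this file] -/
theorem ttGraph_adj {u v : FermionTorus 2 L} :
    (ttGraph L).Adj u v ↔ (torusGraph 2 L).Adj u.toTorusSite v.toTorusSite ∨
      (torusDiagGraph L).Adj u.toTorusSite v.toTorusSite := by
  rw [SimpleGraph.sup_adj, fermionTorusGraph_adj]
  rfl

/-- Every site of the `t–t'` torus has at most `8` neighbours (`x ± e_i`, `x ± (e₁ ± e₂)`).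
[folklore] -/
theorem degree_ttGraph_le (v : FermionTorus 2 L) :
    (Finset.univ.filter ((ttGraph L).Adj v)).card ≤ 8 := by
  classical
  set v' := v.toTorusSite with hv'
  set S₁ : Finset (TorusSite 2 L) := (Finset.univ : Finset (Fin 2 × Bool)).image fun p =>
    if p.2 then v' + Pi.single p.1 1 else v' - Pi.single p.1 1 with hS₁
  set S₂ : Finset (TorusSite 2 L) := (Finset.univ : Finset (Fin 2 × Bool)).image fun p =>
    if p.2 then v' + torusDiagJump L p.1 else v' - torusDiagJump L p.1 with hS₂
  have hsub : (Finset.univ.filter ((ttGraph L).Adj v)).image FermionTorus.toTorusSite ⊆ S₁ ∪ S₂ := by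
    intro z hz
    obtain ⟨w, hw, rfl⟩ := Finset.mem_image.1 hz
    have hadj := (Finset.mem_filter.1 hw).2
    rw [ttGraph_adj] at hadj
    rcases hadj with hnn | hdg
    · rw [torusGraph_adj_iff] at hnn
      obtain ⟨-, ⟨i, h⟩ | ⟨i, h⟩⟩ := hnn
      · exact Finset.mem_union_left _ (Finset.mem_image.2 ⟨(i, true), Finset.mem_univ _, by simp [h, hv']⟩)
      · refine Finset.mem_union_left _ (Finset.mem_image.2 ⟨(i, false), Finset.mem_univ _, ?_⟩)
        simp only [if_false, Bool.false_eq_true]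
        rw [hv', h, add_sub_cancel_right]
    · rw [torusDiagGraph, SimpleGraph.fromRel_adj] at hdg
      obtain ⟨-, ⟨s, h⟩ | ⟨s, h⟩⟩ := hdg
      · exact Finset.mem_union_right _ (Finset.mem_image.2 ⟨(s, true), Finset.mem_univ _, by simp [h, hv']⟩)
      · refine Finset.mem_union_right _ (Finset.mem_image.2 ⟨(s, false), Finset.mem_univ _, ?_⟩)
        simp only [if_false, Bool.false_eq_true]
        rw [hv', h, add_sub_cancel_right]
  have hinj : Function.Injective (FermionTorus.toTorusSite : FermionTorus 2 L → TorusSite 2 L) :=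
    FermionTorus.equivTorusSite.injective
  have h4 : (Finset.univ : Finset (Fin 2 × Bool)).card = 4 := by simp
  calc (Finset.univ.filter ((ttGraph L).Adj v)).card
      = ((Finset.univ.filter ((ttGraph L).Adj v)).image FermionTorus.toTorusSite).card :=
        (Finset.card_image_of_injective _ hinj).symm
    _ ≤ (S₁ ∪ S₂).card := Finset.card_le_card hsub
    _ ≤ S₁.card + S₂.card := Finset.card_union_le _ _
    _ ≤ 4 + 4 := add_le_add (Finset.card_image_le.trans h4.le) (Finset.card_image_le.trans h4.le)
    _ = 8 := rfl

/-! ### The twisted coupling lives on the `t–t'` bonds -/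

omit [NeZero L] in
/-- A unit shift is an edge of the nearest-neighbour torus graph (`L ≥ 3`). [this file] -/
theorem torusGraph_adj_shift (hL : 3 ≤ L) (x : Site 2 L) (i : Fin 2) :
    (torusGraph 2 L).Adj (x.shift i) x := by
  haveI : Fact (1 < L) := ⟨by omega⟩
  rw [torusGraph_adj_iff]
  refine ⟨fun h => ?_, Or.inr ⟨i, rfl⟩⟩
  have h' := congr_fun h i
  simp only [Literature.MathematicalPhysics.QuantumFieldTheory.Site.shift, Pi.add_apply, Pi.single_eq_same,
    add_eq_left] at h'
  exact one_ne_zero h'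

omit [NeZero L] in
/-- A diagonal jump is an edge of the diagonal torus graph (`L ≥ 3`). [this file] -/
theorem torusDiagGraph_adj_add_jump (hL : 3 ≤ L) (x : Site 2 L) (s : Fin 2) :
    (torusDiagGraph L).Adj (x + torusDiagJump L s) x := by
  haveI : Fact (1 < L) := ⟨by omega⟩
  rw [torusDiagGraph, SimpleGraph.fromRel_adj]
  refine ⟨fun h => ?_, Or.inr ⟨s, rfl⟩⟩
  have h' := congr_fun h 0
  rw [Pi.add_apply, show torusDiagJump L s 0 = 1 from by simp [torusDiagJump], add_eq_left] at h'
  exact one_ne_zero h'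

/-- Forward nearest-neighbour bonds are `t–t'` edges. [this file] -/
theorem ttGraph_adj_nnFwdBond (hL : 3 ≤ L) (j : Site 2 L × Fin 2 × Fin 2) :
    (ttGraph L).Adj (nnFwdBond L j).1 (nnFwdBond L j).2.1 := by
  rw [ttGraph_adj]
  simp only [nnFwdBond, FermionTorus.toTorusSite_ofTorusSite]
  exact Or.inl (torusGraph_adj_shift hL j.1 j.2.1)

/-- Backward nearest-neighbour bonds are `t–t'` edges. [this file] -/
theorem ttGraph_adj_nnBwdBond (hL : 3 ≤ L) (j : Site 2 L × Fin 2 × Fin 2) :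
    (ttGraph L).Adj (nnBwdBond L j).1 (nnBwdBond L j).2.1 := by
  rw [ttGraph_adj]
  simp only [nnBwdBond, FermionTorus.toTorusSite_ofTorusSite]
  exact Or.inl (torusGraph_adj_shift hL j.1 j.2.1).symm

/-- Forward diagonal bonds are `t–t'` edges. [this file] -/
theorem ttGraph_adj_diagFwdBond (hL : 3 ≤ L) (j : Fin 2 × Site 2 L × Fin 2) :
    (ttGraph L).Adj (diagFwdBond L j).1 (diagFwdBond L j).2.1 := by
  rw [ttGraph_adj]
  simp only [diagFwdBond, FermionTorus.toTorusSite_ofTorusSite]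
  exact Or.inr (torusDiagGraph_adj_add_jump hL j.2.1 j.1)

/-- Backward diagonal bonds are `t–t'` edges. [this file] -/
theorem ttGraph_adj_diagBwdBond (hL : 3 ≤ L) (j : Fin 2 × Site 2 L × Fin 2) :
    (ttGraph L).Adj (diagBwdBond L j).1 (diagBwdBond L j).2.1 := by
  rw [ttGraph_adj]
  simp only [diagBwdBond, FermionTorus.toTorusSite_ofTorusSite]
  exact Or.inr (torusDiagGraph_adj_add_jump hL j.2.1 j.1).symm

/-- **Support.** A bond carrying a nonzero twisted `t–t'` coupling is a bond of the `t–t'` graph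
(`L ≥ 3`), for every twist `θ`. [programme: bounds.tex §12] -/
theorem ttGraph_adj_of_ttFluxCoupling_ne_zero (hL : 3 ≤ L) (β t' θ : ℝ) (b : Bond (FermionTorus 2 L))
    (hb : ttFluxCoupling L β t' θ b ≠ 0) : (ttGraph L).Adj b.1 b.2.1 := by
  by_contra hadj
  apply hb
  simp only [ttFluxCoupling, Pi.add_apply]
  rw [indicatorCoupling_eq_zero, indicatorCoupling_eq_zero, indicatorCoupling_eq_zero,
    indicatorCoupling_eq_zero, add_zero, add_zero, add_zero] <;>
  · rintro j rfl
    first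
    | exact hadj (ttGraph_adj_nnFwdBond hL j)
    | exact hadj (ttGraph_adj_nnBwdBond hL j)
    | exact hadj (ttGraph_adj_diagFwdBond hL j)
    | exact hadj (ttGraph_adj_diagBwdBond hL j)

/-- A bond with nonzero twisted coupling is a bond of the `t–t'` graph. [this file] -/
theorem mem_hubbardBonds_ttGraph_of_ne_zero (hL : 3 ≤ L) {β t' θ : ℝ} {b : Bond (FermionTorus 2 L)}
    (hb : ttFluxCoupling L β t' θ b ≠ 0) : b ∈ hubbardBonds (ttGraph L) :=
  (mem_hubbardBonds _).2 (ttGraph_adj_of_ttFluxCoupling_ne_zero hL β t' θ b hb)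

/-! ### The size of the twisted coupling -/

/-- `FermionTorus.ofTorusSite` is injective. [this file] -/
theorem ofTorusSite_injective : Function.Injective (FermionTorus.ofTorusSite : TorusSite 2 L → FermionTorus 2 L) :=
  FermionTorus.equivTorusSite.symm.injective

omit [NeZero L] in
/-- Shifting a fixed site is injective in the direction (`L ≥ 3`). [this file] -/
theorem shift_injective (hL : 3 ≤ L) (x : Site 2 L) : Function.Injective (x.shift) := by
  haveI : Fact (1 < L) := ⟨by omega⟩
  intro i i' h
  by_contra hne
  have h' := congr_fun h i
  simp only [Literature.MathematicalPhysics.QuantumFieldTheory.Site.shift, Pi.add_apply, Pi.single_eq_same,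
    Pi.single_eq_of_ne hne, add_right_inj] at h'
  exact one_ne_zero h'

/-- The diagonal jump determines its label (`L ≥ 3`). [this file] -/
theorem torusDiagJump_injective (hL : 3 ≤ L) : Function.Injective (torusDiagJump L) := by
  intro s s' h
  have h' := congr_fun h 1
  -- `(1 : ZMod L) ≠ -1` for `L ≥ 3` (folklore; kept local — the tree holds a copy in another target)
  have one_ne_neg_one_zmod : ∀ _ : 3 ≤ L, (1 : ZMod L) ≠ -1 := fun _ h1 => by
    haveI : Fact (1 < L) := ⟨by omega⟩
    have h1' := (zmod_eq_neg_one_iff_val (1 : ZMod L)).1 h1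
    rw [ZMod.val_one] at h1'
    omega
  have h01 : ∀ j : Fin 2, j = 0 ∨ j = 1 := by decide
  rcases h01 s with rfl | rfl <;> rcases h01 s' with rfl | rfl
  · rfl
  · exfalso; simp [torusDiagJump] at h'; exact one_ne_neg_one_zmod hL h'
  · exfalso; simp [torusDiagJump] at h'; exact one_ne_neg_one_zmod hL h'.symm
  · rfl

/-- `nnFwdBond` is injective. [this file] -/
theorem nnFwdBond_injective (hL : 3 ≤ L) : Function.Injective (nnFwdBond L) := by
  rintro ⟨x, i, σ⟩ ⟨x', i', σ'⟩ h
  simp only [nnFwdBond, Prod.mk.injEq] at h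
  obtain ⟨h1, h2, h3⟩ := h
  have hx : x = x' := ofTorusSite_injective h2
  subst hx; subst h3
  have hi : i = i' := shift_injective hL x (ofTorusSite_injective h1)
  subst hi; rfl

/-- Auxiliary lemma `nnBwdBond_injective` (support step for the results of this file; see the module docstring). [this file] -/
theorem nnBwdBond_injective (hL : 3 ≤ L) : Function.Injective (nnBwdBond L) := by
  rintro ⟨x, i, σ⟩ ⟨x', i', σ'⟩ h
  simp only [nnBwdBond, Prod.mk.injEq] at h
  obtain ⟨h1, h2, h3⟩ := h
  have hx : x = x' := ofTorusSite_injective h1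
  subst hx; subst h3
  have hi : i = i' := shift_injective hL x (ofTorusSite_injective h2)
  subst hi; rfl

/-- Auxiliary lemma `diagFwdBond_injective` (support step for the results of this file; see the module docstring). [this file] -/
theorem diagFwdBond_injective (hL : 3 ≤ L) : Function.Injective (diagFwdBond L) := by
  rintro ⟨s, x, σ⟩ ⟨s', x', σ'⟩ h
  simp only [diagFwdBond, Prod.mk.injEq] at h
  obtain ⟨h1, h2, h3⟩ := h
  have hx : x = x' := ofTorusSite_injective h2
  subst hx; subst h3
  have hs : s = s' := torusDiagJump_injective hL (add_left_cancel (ofTorusSite_injective h1))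
  subst hs; rfl

/-- Auxiliary lemma `diagBwdBond_injective` (support step for the results of this file; see the module docstring). [this file] -/
theorem diagBwdBond_injective (hL : 3 ≤ L) : Function.Injective (diagBwdBond L) := by
  rintro ⟨s, x, σ⟩ ⟨s', x', σ'⟩ h
  simp only [diagBwdBond, Prod.mk.injEq] at h
  obtain ⟨h1, h2, h3⟩ := h
  have hx : x = x' := ofTorusSite_injective h1
  subst hx; subst h3
  have hs : s = s' := torusDiagJump_injective hL (add_left_cancel (ofTorusSite_injective h2))
  subst hs; rfl

omit [NeZero L] in
/-- An indicator coupling with injective index map is bounded by the bound on its values.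
[folklore bookkeeping] -/
theorem norm_indicatorCoupling_le {ι : Type*} [Fintype ι] {a : ι → Bond (FermionTorus 2 L)}
    (ha : Function.Injective a) {r : ι → ℂ} {M : ℝ} (hM : 0 ≤ M) (hr : ∀ j, ‖r j‖ ≤ M)
    (b : Bond (FermionTorus 2 L)) : ‖indicatorCoupling a r b‖ ≤ M := by
  by_cases h : ∃ j, b = a j
  · obtain ⟨j, rfl⟩ := h
    have hval : indicatorCoupling a r (a j) = r j := by
      simp only [indicatorCoupling]
      rw [Finset.sum_eq_single j]
      · rw [if_pos rfl]
      · intro j' _ hj'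
        rw [if_neg]
        exact fun h => hj' (ha h).symm
      · intro hj; exact absurd (Finset.mem_univ j) hj
    rw [hval]; exact hr j
  · rw [indicatorCoupling_eq_zero a r (fun j hj => h ⟨j, hj⟩), norm_zero]; exact hM

/-- Auxiliary lemma `norm_seamAmp` (support step for the results of this file; see the module docstring). [this file] -/
theorem norm_seamAmp (θ : ℝ) (x : Site 2 L) (i : Fin 2) : ‖seamAmp L θ x i‖ = 1 := by
  simp only [seamAmp, Circle.norm_coe]

/-- **Size of the twisted coupling**: `|c_θ(b)| ≤ |β| (2 + 2|t'|)` for every bond and every twist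
(`L ≥ 3`; crude — the four bond families have disjoint images, so `|β| max(1,|t'|)` also holds).
[programme: bounds.tex §12] -/
theorem norm_ttFluxCoupling_le (hL : 3 ≤ L) (β t' θ : ℝ) (b : Bond (FermionTorus 2 L)) :
    ‖ttFluxCoupling L β t' θ b‖ ≤ |β| * (2 + 2 * |t'|) := by
  have hβ : 0 ≤ |β| := abs_nonneg β
  have hβt : 0 ≤ |β| * |t'| := mul_nonneg hβ (abs_nonneg t')
  have e1 : ∀ j : Site 2 L × Fin 2 × Fin 2, ‖(β : ℂ) * seamAmp L θ j.1 j.2.1‖ ≤ |β| := fun j => by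
    rw [norm_mul, Complex.norm_real, Real.norm_eq_abs, norm_seamAmp, mul_one]
  have e2 : ∀ j : Site 2 L × Fin 2 × Fin 2, ‖(β : ℂ) * conj (seamAmp L θ j.1 j.2.1)‖ ≤ |β| := fun j => by
    rw [norm_mul, Complex.norm_real, Real.norm_eq_abs, RCLike.norm_conj, norm_seamAmp, mul_one]
  have e3 : ∀ j : Fin 2 × Site 2 L × Fin 2, ‖(β : ℂ) * (t' : ℂ) * seamAmp L θ j.2.1 0‖ ≤ |β| * |t'| := fun j => by
    rw [norm_mul, norm_mul, Complex.norm_real, Complex.norm_real, Real.norm_eq_abs, Real.norm_eq_abs,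
      norm_seamAmp, mul_one]
  have e4 : ∀ j : Fin 2 × Site 2 L × Fin 2, ‖(β : ℂ) * (t' : ℂ) * conj (seamAmp L θ j.2.1 0)‖ ≤ |β| * |t'| := fun j => by
    rw [norm_mul, norm_mul, Complex.norm_real, Complex.norm_real, Real.norm_eq_abs, Real.norm_eq_abs,
      RCLike.norm_conj, norm_seamAmp, mul_one]
  simp only [ttFluxCoupling, Pi.add_apply]
  calc _ ≤ ‖indicatorCoupling (nnFwdBond L) (fun j => (β : ℂ) * seamAmp L θ j.1 j.2.1) b +
          indicatorCoupling (nnBwdBond L) (fun j => (β : ℂ) * conj (seamAmp L θ j.1 j.2.1)) b +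
          indicatorCoupling (diagFwdBond L) (fun j => (β : ℂ) * (t' : ℂ) * seamAmp L θ j.2.1 0) b‖ +
        ‖indicatorCoupling (diagBwdBond L) (fun j => (β : ℂ) * (t' : ℂ) * conj (seamAmp L θ j.2.1 0)) b‖ :=
        norm_add_le _ _
    _ ≤ (|β| + |β| + |β| * |t'|) + |β| * |t'| := by
        refine add_le_add ((norm_add_le _ _).trans (add_le_add ((norm_add_le _ _).trans
          (add_le_add ?_ ?_)) ?_)) ?_
        · exact norm_indicatorCoupling_le (nnFwdBond_injective hL) hβ e1 b
        · exact norm_indicatorCoupling_le (nnBwdBond_injective hL) hβ e2 b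
        · exact norm_indicatorCoupling_le (diagFwdBond_injective hL) hβt e3 b
        · exact norm_indicatorCoupling_le (diagBwdBond_injective hL) hβt e4 b
    _ = |β| * (2 + 2 * |t'|) := by ring

end TorusGraph

noncomputable section

/-! ### The twisted torus: polymer representation on the `t–t'` bonds and KP smallness -/

section Torus

variable {L : ℕ} [NeZero L]

/-- The polymer representation of #181.4 on the bond universe `hubbardBonds (ttGraph L)`
(any universe containing the support of `c_θ` gives the same activities on the clusters that
matter; this one is the graph form the smallness estimate is stated for). [this file + #181.4] -/
theorem partitionFn_hubbardTorusTT'FluxMu_eq_polymer_ttGraph (hL : 3 ≤ L) (β t' U μ θ : ℝ) :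
    (hubbardTorusTT'Flux L t' U θ - (μ : ℂ) • totalNumber).partitionFn β =
      polymerGasZ (hubbardBonds (ttGraph L)) (β : ℂ) (U : ℂ) (μ : ℂ) (ttFluxCoupling L β t' θ) := by
  rw [partitionFn_hubbardTorusTT'FluxMu_eq_Zc hL]
  exact Zc_eq_polymerGasZ (atomicPartitionFn_real_ne_zero β U μ) _ _
    (fun b hb => mem_hubbardBonds_ttGraph_of_ne_zero hL hb)

/-- **KP smallness of the twisted activities** (bounds.tex Lemmas 12.3–12.4 for the `t–t'` torus):
with `s = |β|(2+2|t'|) ≤ 1` and `65² e⁶ s ≤ 1/2`, for every site `x`, every twist `θ` and every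
family `𝒜` of site sets containing `x`, `Σ_{A∈𝒜} |ρ_θ(A)| e^{2|A|} ≤ 64 e⁶ s` — uniformly in the
on-site data `U, μ` (site ratio `= 1` for real parameters). [this file] -/
theorem sum_norm_siteActivityC_ttFlux_le (hL : 3 ≤ L) (β t' U μ θ : ℝ)
    (hs1 : |β| * (2 + 2 * |t'|) ≤ 1)
    (hsmall : (65 : ℝ) ^ 2 * (Real.exp 6 * (|β| * (2 + 2 * |t'|))) ≤ 1 / 2)
    (x : FermionTorus 2 L) (𝒜 : Finset (Finset (FermionTorus 2 L))) (h𝒜 : ∀ A ∈ 𝒜, x ∈ A) :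
    ∑ A ∈ 𝒜, ‖siteActivityC (hubbardBonds (ttGraph L)) (β : ℂ) (U : ℂ) (μ : ℂ)
        (ttFluxCoupling L β t' θ) A‖ * Real.exp (2 * A.card) ≤
      64 * (Real.exp 6 * (|β| * (2 + 2 * |t'|))) := by
  have hs0 : 0 ≤ |β| * (2 + 2 * |t'|) := by positivity
  have hr : siteRatio (β : ℂ) (U : ℂ) (μ : ℂ) ≤ 1 := (siteRatio_ofReal β U μ).le
  have hsmall' : ((8 * 8 : ℕ) + 1 : ℝ) ^ 2 * (Real.exp 6 * (1 : ℝ) ^ 2 * (|β| * (2 + 2 * |t'|))) ≤ 1 / 2 := by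
    rw [one_pow, mul_one]; push_cast; norm_num; linarith [hsmall]
  have h := sum_norm_siteActivityC_mul_exp_le (G := ttGraph L) (Δ := 8) degree_ttGraph_le
    (atomicPartitionFn_real_ne_zero β U μ) le_rfl hr hs0 hs1
    (norm_ttFluxCoupling_le hL β t' θ) hsmall' x 𝒜 h𝒜
  rw [one_pow, mul_one] at h
  refine h.trans (le_of_eq ?_)
  push_cast; ring

/-! ### Node: KP smallness of the twisted polymer gas -/

/-- **Node (bounds.tex §12, Lemmas 12.2–12.4 assembled for the seam-twisted `t–t'` torus; PROVED
below).** For `L ≥ 3`, real `β, t', U, μ` and EVERY twist `θ`: if `s := |β|(2+2|t'|) ≤ 1` and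
`65² e⁶ s ≤ 1/2`, then (1) `Tr e^{-β(H^{tt'}_L(t',U;θ) - μN)} = z₀^{L²} Ξ(ρ_θ)` with
`ρ_θ = siteActivityC (hubbardBonds (ttGraph L)) β U μ c_θ`, and (2) the activities satisfy the
one-site Kotecký–Preiss bound `Σ_{A ∋ x} |ρ_θ(A)| e^{2|A|} ≤ 64 e⁶ s` at every site `x` —
uniformly in `U` (both signs), `μ` and `θ`. With #181.4's winding dichotomy this is the whole
model-specific input of Theorem 12 (i). [programme node: bounds.tex §12; cites Ueltschi1999 §3,
KoteckyPreiss1986 Thm. 1] -/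
@[conjecture] def TwistedTorusActivitySmallness : Prop :=
  ∀ (L : ℕ) [NeZero L], 3 ≤ L → ∀ (β t' U μ θ : ℝ),
    |β| * (2 + 2 * |t'|) ≤ 1 →
    (65 : ℝ) ^ 2 * (Real.exp 6 * (|β| * (2 + 2 * |t'|))) ≤ 1 / 2 →
      (hubbardTorusTT'Flux L t' U θ - (μ : ℂ) • totalNumber).partitionFn β =
          polymerGasZ (hubbardBonds (ttGraph L)) (β : ℂ) (U : ℂ) (μ : ℂ) (ttFluxCoupling L β t' θ) ∧
      ∀ (x : FermionTorus 2 L) (𝒜 : Finset (Finset (FermionTorus 2 L))), (∀ A ∈ 𝒜, x ∈ A) →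
        ∑ A ∈ 𝒜, ‖siteActivityC (hubbardBonds (ttGraph L)) (β : ℂ) (U : ℂ) (μ : ℂ)
            (ttFluxCoupling L β t' θ) A‖ * Real.exp (2 * A.card) ≤
          64 * (Real.exp 6 * (|β| * (2 + 2 * |t'|)))

/-- PROOF of the node `TwistedTorusActivitySmallness`. [this file] -/
theorem twistedTorusActivitySmallness_holds : TwistedTorusActivitySmallness := by
  intro L _ hL β t' U μ θ hs1 hsmall
  exact ⟨partitionFn_hubbardTorusTT'FluxMu_eq_polymer_ttGraph hL β t' U μ θ,
    fun x 𝒜 h𝒜 => sum_norm_siteActivityC_ttFlux_le hL β t' U μ θ hs1 hsmall x 𝒜 h𝒜⟩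

end Torus

end

end Summit.HubbardSuperconductivity.HubbardLadder.Bounds
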